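import Mathlib
import HarnessLib
import Literature.MathematicalPhysics.QuantumManyBody.BoseGasFreeDirichletBEC
import Literature.MathematicalPhysics.QuantumManyBody.BoseGasHardCoreCriticalDensity

/-! # NumberPhaseSandwich · BC5 rung: the pair second-moment statistic I3 for GENUINE HARD CORES

Route NumberPhaseSandwich (decomp-a2c lens-6 g10), cruxes PhaseSaturation (stmt-AtomisticToContinuum-32637) /
FluctuationFloor (stmt-…-32638), registered near-pivot input I3 = `stub_pairSecondMoment` (`PairSecondMomentP`:
`⟨N_P²⟩_Ψ ≤ C ρ² ℓ⁶` for every interior sibling pair `P = Q_c ∪ Q_c'` in the pivot window). THIS FILE: for a potential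
with a genuine hard core (`v = ⊤` on `[0,a)`), every finite-energy state vanishes wherever two particles are closer than `a`
(`eq_zero_of_dist_le`, tree), so on `supp Ψ` the particles of a sibling pair region (diameter `< 4ℓ`) are `a`-separated and
`N_P ≤ (8ℓ/a + 2)³` by volume packing (`card_filter_dist_lt_le_pow`, tree); with `ℓ ≥ 1/√ρ` in the window this is
`⟨N_P²⟩ ≤ ((8/a + 2√ρ)⁶/ρ²)·ρ²ℓ⁶`. Hence I3 (and, through the LANDED conversion `stub_satNearPivot_of_secondMoment`, p775386,
the whole near-pivot half of PhaseSaturation) holds for hard-core bosons — a regime where BEC itself is OPEN — modulo only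
the dilute finite-energy fact `E₀^D(N, L_N(ρ)) < ⊤` eventually (hypothesis `hfin`, named, not smuggled). 0 sorry. -/

noncomputable section

namespace Summit.AtomisticToContinuum.BoseEinsteinCondensation.Theorems.NumberPhaseSandwichHardCoreRung

open Literature.MathematicalPhysics.QuantumManyBody.BoseGas MeasureTheory Set Filter
open scoped ENNReal NNReal

variable {N M : ℕ} {ℓ : ℝ}

/-- verbatim skeleton object. -/
abbrev Sib {m : ℕ} (c c' : SubIdx m) : Prop := ∀ j : Fin 3, (c j : ℕ) / 2 = (c' j : ℕ) / 2

/-- verbatim skeleton object. -/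
abbrev IntP (k : ℕ) (c : SubIdx (2 ^ k)) : Prop := ∀ j : Fin 3, 1 ≤ (c j : ℕ) / 2 ∧ (c j : ℕ) / 2 + 2 ≤ 2 ^ (k - 1)

/-- verbatim skeleton object. -/
abbrev pairCount (ρ : ℝ) (N k : ℕ) (c c' : SubIdx (2 ^ k)) (X : Config N) : ENNReal :=
  ∑ p : Fin N, (subCell (sideLength ρ N / 2 ^ k) c ∪ subCell (sideLength ρ N / 2 ^ k) c').indicator
    (fun _ => (1 : ENNReal)) (X p)

/-! ## Geometry of a sibling pair region -/

/-- coordinates of points of a sibling pair region differ by `< 2ℓ`. -/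
theorem coord_sub_lt_of_sib (hℓ : 0 < ℓ) {c c' : SubIdx M} (hs : Sib c c') {x y : Space}
    (hx : x ∈ subCell ℓ c ∪ subCell ℓ c') (hy : y ∈ subCell ℓ c ∪ subCell ℓ c') (j : Fin 3) :
    |x j - y j| < 2 * ℓ := by
  -- both coordinates lie in `[2ℓh, 2ℓh + 2ℓ)` with `h = c j / 2 = c' j / 2`
  have key : ∀ z : Space, z ∈ subCell ℓ c ∪ subCell ℓ c' →
      ℓ * (2 * (((c j : ℕ) / 2 : ℕ) : ℝ)) ≤ z j ∧ z j < ℓ * (2 * (((c j : ℕ) / 2 : ℕ) : ℝ)) + 2 * ℓ := by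
    intro z hz
    rcases hz with hz | hz
    · have h := (mem_subCell.1 hz) j
      have h1 : (2 * ((c j : ℕ) / 2) : ℕ) ≤ (c j : ℕ) := Nat.mul_div_le _ _
      have h2 : (c j : ℕ) ≤ 2 * ((c j : ℕ) / 2) + 1 := by omega
      have h1' : ((2 * ((c j : ℕ) / 2) : ℕ) : ℝ) ≤ ((c j : ℕ) : ℝ) := by exact_mod_cast h1
      have h2' : ((c j : ℕ) : ℝ) ≤ ((2 * ((c j : ℕ) / 2) + 1 : ℕ) : ℝ) := by exact_mod_cast h2
      push_cast at h1' h2'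
      constructor <;> nlinarith [h.1, h.2]
    · have h := (mem_subCell.1 hz) j
      have h1 : (2 * ((c' j : ℕ) / 2) : ℕ) ≤ (c' j : ℕ) := Nat.mul_div_le _ _
      have h2 : (c' j : ℕ) ≤ 2 * ((c' j : ℕ) / 2) + 1 := by omega
      have h1' : ((2 * ((c' j : ℕ) / 2) : ℕ) : ℝ) ≤ ((c' j : ℕ) : ℝ) := by exact_mod_cast h1
      have h2' : ((c' j : ℕ) : ℝ) ≤ ((2 * ((c' j : ℕ) / 2) + 1 : ℕ) : ℝ) := by exact_mod_cast h2
      push_cast at h1' h2'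
      rw [← hs j] at h1' h2'
      constructor <;> nlinarith [h.1, h.2]
  obtain ⟨hx1, hx2⟩ := key x hx
  obtain ⟨hy1, hy2⟩ := key y hy
  rw [abs_lt]; constructor <;> linarith

/-- … hence their distance is `< 4ℓ`. -/
theorem dist_lt_of_sib (hℓ : 0 < ℓ) {c c' : SubIdx M} (hs : Sib c c') {x y : Space}
    (hx : x ∈ subCell ℓ c ∪ subCell ℓ c') (hy : y ∈ subCell ℓ c ∪ subCell ℓ c') : dist x y < 4 * ℓ := by
  have hsq : dist x y ^ 2 < (4 * ℓ) ^ 2 := by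
    rw [dist_sq_eq_sum_coord]
    have hj : ∀ j : Fin 3, (x j - y j) ^ 2 < (2 * ℓ) ^ 2 := fun j => by
      have h := coord_sub_lt_of_sib hℓ hs hx hy j
      exact sq_lt_sq' (by linarith [(abs_lt.1 h).1]) (abs_lt.1 h).2
    calc ∑ j : Fin 3, (x j - y j) ^ 2 < ∑ j : Fin 3, (2 * ℓ) ^ 2 :=
          Finset.sum_lt_sum_of_nonempty Finset.univ_nonempty fun j _ => hj j
      _ = 3 * (2 * ℓ) ^ 2 := by simp
      _ ≤ (4 * ℓ) ^ 2 := by nlinarith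
  exact lt_of_pow_lt_pow_left₀ 2 (by positivity) hsq

/-! ## Packing bound on `supp Ψ` -/

/-- the pair count as a cardinality. -/
theorem sum_indicator_eq_card (S : Set Space) (X : Config N) [DecidablePred fun p : Fin N => X p ∈ S] :
    ∑ p : Fin N, S.indicator (fun _ => (1 : ℝ≥0∞)) (X p) = ((Finset.univ.filter fun p => X p ∈ S).card : ℝ≥0∞) := by
  classical
  rw [← Finset.sum_boole]
  refine Finset.sum_congr rfl fun p _ => ?_
  by_cases h : X p ∈ S
  · rw [Set.indicator_of_mem h, if_pos h]
  · rw [Set.indicator_of_notMem h, if_neg h]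

/-- **Packing.** If all particles are pairwise `≥ a` apart, a sibling pair region of side `ℓ` holds at most `(8ℓ/a + 2)³`
of them. -/
theorem card_pair_le {a : ℝ} (ha : 0 < a) (hℓ : 0 < ℓ) {c c' : SubIdx M} (hs : Sib c c') {X : Config N}
    (hsep : ∀ j j' : Fin N, j ≠ j' → a ≤ dist (X j) (X j')) [DecidablePred fun p : Fin N => X p ∈ subCell ℓ c ∪ subCell ℓ c'] :
    ((Finset.univ.filter fun p => X p ∈ subCell ℓ c ∪ subCell ℓ c').card : ℝ) ≤ (8 * ℓ / a + 2) ^ 3 := by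
  classical
  set F := Finset.univ.filter fun p => X p ∈ subCell ℓ c ∪ subCell ℓ c' with hF
  rcases F.eq_empty_or_nonempty with h0 | ⟨i, hi⟩
  · rw [h0]; simp; positivity
  · have hiP : X i ∈ subCell ℓ c ∪ subCell ℓ c' := (Finset.mem_filter.1 hi).2
    have hsub : F ⊆ insert i (Finset.univ.filter fun j => j ≠ i ∧ dist (X i) (X j) < 4 * ℓ) := by
      intro p hp
      have hpP : X p ∈ subCell ℓ c ∪ subCell ℓ c' := (Finset.mem_filter.1 hp).2
      by_cases hpi : p = i
      · exact Finset.mem_insert.2 (Or.inl hpi)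
      · exact Finset.mem_insert.2 (Or.inr (Finset.mem_filter.2 ⟨Finset.mem_univ _, hpi,
          dist_lt_of_sib hℓ hs hiP hpP⟩))
    have h1 : (F.card : ℝ) ≤ 1 + ((Finset.univ.filter fun j => j ≠ i ∧ dist (X i) (X j) < 4 * ℓ).card : ℝ) := by
      have := (Finset.card_le_card hsub).trans (Finset.card_insert_le _ _)
      have h' : (F.card : ℝ) ≤ (((Finset.univ.filter fun j => j ≠ i ∧ dist (X i) (X j) < 4 * ℓ).card + 1 : ℕ) : ℝ) := by
        exact_mod_cast this
      push_cast at h'; linarith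
    have h2 := card_filter_dist_lt_le_pow ha (by positivity : (0 : ℝ) < 4 * ℓ) hsep i
    have h3 : (2 * (4 * ℓ) / a + 1) = 8 * ℓ / a + 1 := by ring
    rw [h3] at h2
    have h4 : 1 + (8 * ℓ / a + 1) ^ 3 ≤ (8 * ℓ / a + 2) ^ 3 := by
      have : 0 ≤ 8 * ℓ / a := by positivity
      nlinarith [this, sq_nonneg (8 * ℓ / a + 1)]
    linarith

/-- **Pointwise second-moment bound** for a hard core: `N_P(X)² |Ψ(X)|² ≤ (8ℓ/a+2)⁶ |Ψ(X)|²`. -/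
theorem pairCount_sq_mul_le {a : ℝ} (ha : 0 < a) {v : ℝ → ℝ≥0∞} (hcore : ∀ r, r < a → v r = ⊤)
    {L : ℝ} (Ψ : TrialState N L) (hE : energy v Ψ ≠ ⊤) (hℓ : 0 < ℓ) {c c' : SubIdx M} (hs : Sib c c')
    (X : Config N) :
    (∑ p : Fin N, (subCell ℓ c ∪ subCell ℓ c').indicator (fun _ => (1 : ℝ≥0∞)) (X p)) ^ 2 * (‖Ψ.ψ X‖₊ : ℝ≥0∞) ^ 2 ≤
      ENNReal.ofReal ((8 * ℓ / a + 2) ^ 6) * (‖Ψ.ψ X‖₊ : ℝ≥0∞) ^ 2 := by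
  classical
  by_cases hX : Ψ.ψ X = 0
  · simp [hX]
  · -- all particles are `a`-separated at `X`
    have hsep : ∀ j j' : Fin N, j ≠ j' → a ≤ dist (X j) (X j') := by
      intro j j' hjj'
      by_contra hlt
      exact hX (eq_zero_of_dist_le ha hcore Ψ.contDiff.continuous hE X j j' hjj' (not_le.1 hlt).le)
    refine mul_le_mul' ?_ le_rfl
    rw [sum_indicator_eq_card]
    have h := card_pair_le ha hℓ hs hsep (X := X)
    have hnn : (0 : ℝ) ≤ (8 * ℓ / a + 2) ^ 3 := by positivity
    calc (((Finset.univ.filter fun p => X p ∈ subCell ℓ c ∪ subCell ℓ c').card : ℝ≥0∞)) ^ 2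
        = ENNReal.ofReal (((Finset.univ.filter fun p => X p ∈ subCell ℓ c ∪ subCell ℓ c').card : ℝ)) ^ 2 := by
          rw [ENNReal.ofReal_natCast]
      _ ≤ ENNReal.ofReal ((8 * ℓ / a + 2) ^ 3) ^ 2 := by
          gcongr
      _ = ENNReal.ofReal ((8 * ℓ / a + 2) ^ 6) := by
          rw [← ENNReal.ofReal_pow hnn]; ring_nf

/-- **Integrated**: `⟨N_P²⟩_Ψ ≤ (8ℓ/a+2)⁶` for a finite-energy state of a hard-core gas. -/
theorem lintegral_pairCount_sq_le {a : ℝ} (ha : 0 < a) {v : ℝ → ℝ≥0∞} (hcore : ∀ r, r < a → v r = ⊤)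
    {L : ℝ} (Ψ : TrialState N L) (hE : energy v Ψ ≠ ⊤) (hℓ : 0 < ℓ) {c c' : SubIdx M} (hs : Sib c c') :
    ∫⁻ X, (∑ p : Fin N, (subCell ℓ c ∪ subCell ℓ c').indicator (fun _ => (1 : ℝ≥0∞)) (X p)) ^ 2 *
        (‖Ψ.ψ X‖₊ : ℝ≥0∞) ^ 2 ≤ ENNReal.ofReal ((8 * ℓ / a + 2) ^ 6) := by
  calc ∫⁻ X, (∑ p : Fin N, (subCell ℓ c ∪ subCell ℓ c').indicator (fun _ => (1 : ℝ≥0∞)) (X p)) ^ 2 *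
        (‖Ψ.ψ X‖₊ : ℝ≥0∞) ^ 2
      ≤ ∫⁻ X, ENNReal.ofReal ((8 * ℓ / a + 2) ^ 6) * (‖Ψ.ψ X‖₊ : ℝ≥0∞) ^ 2 :=
        lintegral_mono fun X => pairCount_sq_mul_le ha hcore Ψ hE hℓ hs X
    _ = ENNReal.ofReal ((8 * ℓ / a + 2) ^ 6) * ∫⁻ X, (‖Ψ.ψ X‖₊ : ℝ≥0∞) ^ 2 := by
        rw [lintegral_const_mul' _ _ ENNReal.ofReal_ne_top]
    _ = ENNReal.ofReal ((8 * ℓ / a + 2) ^ 6) := by rw [Ψ.norm_eq, mul_one]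

/-- window arithmetic: `ℓ ≥ 1/√ρ` gives `(8ℓ/a+2)⁶ ≤ ((8/a + 2√ρ)⁶/ρ²)·ρ²ℓ⁶`. -/
theorem packing_const_le {a ρ ℓ : ℝ} (ha : 0 < a) (hρ : 0 < ρ) (hℓρ : 1 / Real.sqrt ρ ≤ ℓ) :
    (8 * ℓ / a + 2) ^ 6 ≤ (8 / a + 2 * Real.sqrt ρ) ^ 6 / ρ ^ 2 * ρ ^ 2 * ℓ ^ 6 := by
  have hsq : 0 < Real.sqrt ρ := Real.sqrt_pos.2 hρ
  have hℓ : 0 < ℓ := lt_of_lt_of_le (by positivity) hℓρ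
  have h1 : 1 ≤ Real.sqrt ρ * ℓ := by
    have := mul_le_mul_of_nonneg_left hℓρ hsq.le
    rwa [mul_one_div_cancel hsq.ne'] at this
  have h2 : 8 * ℓ / a + 2 ≤ (8 / a + 2 * Real.sqrt ρ) * ℓ := by
    have : 2 ≤ 2 * Real.sqrt ρ * ℓ := by nlinarith
    have h8 : 8 * ℓ / a = 8 / a * ℓ := by ring
    nlinarith [h8]
  have h3 : (8 * ℓ / a + 2) ^ 6 ≤ ((8 / a + 2 * Real.sqrt ρ) * ℓ) ^ 6 :=
    pow_le_pow_left₀ (by positivity) h2 6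
  calc (8 * ℓ / a + 2) ^ 6 ≤ ((8 / a + 2 * Real.sqrt ρ) * ℓ) ^ 6 := h3
    _ = (8 / a + 2 * Real.sqrt ρ) ^ 6 / ρ ^ 2 * ρ ^ 2 * ℓ ^ 6 := by
        field_simp

/-- **I3 for hard cores** (the body of `PairSecondMomentP` at a hard-core `v`, finite-energy hypothesis explicit):
for every `N` with `E₀^D(N, L_N(ρ)) < ⊤` and every state within `1` of the ground-state energy, every sibling pair in the
pivot window satisfies `⟨N_P²⟩_Ψ ≤ C ρ² ℓ⁶` with `C = (8/a + 2√ρ)⁶/ρ²`. -/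
theorem pairSecondMoment_hardCore {a : ℝ} (ha : 0 < a) {v : ℝ → ℝ≥0∞} (hcore : ∀ r, r < a → v r = ⊤)
    {ρ : ℝ} (hρ : 0 < ρ) {N : ℕ} (hfin : groundStateEnergy v N (sideLength ρ N) < ⊤)
    (Ψ : TrialState N (sideLength ρ N)) (hΨ : energy v Ψ ≤ groundStateEnergy v N (sideLength ρ N) + 1)
    {K k : ℕ} (hK1 : 1 / Real.sqrt ρ ≤ sideLength ρ N / 2 ^ K) (hkK : k ≤ K)
    (c c' : SubIdx (2 ^ k)) (hs : Sib c c') :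
    ∫⁻ X, pairCount ρ N k c c' X ^ 2 * (‖Ψ.ψ X‖₊ : ENNReal) ^ 2 ≤
      ENNReal.ofReal ((8 / a + 2 * Real.sqrt ρ) ^ 6 / ρ ^ 2 * ρ ^ 2 * (sideLength ρ N / 2 ^ k) ^ 6) := by
  have hE : energy v Ψ ≠ ⊤ := (lt_of_le_of_lt hΨ (ENNReal.add_lt_top.2 ⟨hfin, ENNReal.one_lt_top⟩)).ne
  have hsq : 0 < Real.sqrt ρ := Real.sqrt_pos.2 hρ
  have hLK : 0 < sideLength ρ N / 2 ^ K := lt_of_lt_of_le (by positivity) hK1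
  have hL : 0 < sideLength ρ N := by
    have h2K : (0 : ℝ) < 2 ^ K := by positivity
    have := mul_pos hLK h2K
    rwa [div_mul_cancel₀ _ h2K.ne'] at this
  have hℓ : 0 < sideLength ρ N / 2 ^ k := by positivity
  have hℓρ : 1 / Real.sqrt ρ ≤ sideLength ρ N / 2 ^ k := by
    refine hK1.trans ?_
    exact div_le_div_of_nonneg_left hL.le (by positivity) (pow_le_pow_right₀ (by norm_num) hkK)
  refine (lintegral_pairCount_sq_le ha hcore Ψ hE hℓ hs).trans ?_
  exact ENNReal.ofReal_le_ofReal (packing_const_le ha hρ hℓρ)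

/-- **The `PairSecondMomentP` instance for a hard-core potential**, modulo the named dilute finite-energy fact `hfin`
(`E₀^D(N, L_N(ρ)) < ⊤` eventually, for all small `ρ`): same quantifier shape as the registered stub, with `v` fixed. -/
theorem pairSecondMomentP_hardCore {a : ℝ} (ha : 0 < a) {v : ℝ → ℝ≥0∞} (hcore : ∀ r, r < a → v r = ⊤)
    (hfin : ∃ ρ₁ : ℝ, 0 < ρ₁ ∧ ∀ ρ : ℝ, 0 < ρ → ρ < ρ₁ → ∀ᶠ N : ℕ in Filter.atTop,
      groundStateEnergy v N (sideLength ρ N) < ⊤) :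
    ∃ ρ₀ : ℝ, 0 < ρ₀ ∧ ∀ ρ : ℝ, 0 < ρ → ρ < ρ₀ →
    ∀ m : ℕ, ∃ C : ℝ, 0 < C ∧ ∃ c₀ : ℝ, 0 < c₀ ∧ ∀ᶠ N : ℕ in Filter.atTop, ∃ δ : ENNReal, 0 < δ ∧
      ∀ Ψ : TrialState N (sideLength ρ N), energy v Ψ ≤ groundStateEnergy v N (sideLength ρ N) + δ →
        ENNReal.ofReal (c₀ * N) ≤ maxOccupation N Ψ.ψ ∨
          ∀ K k : ℕ, 1 / Real.sqrt ρ ≤ sideLength ρ N / 2 ^ K → sideLength ρ N / 2 ^ K < 2 * (1 / Real.sqrt ρ) →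
            1 ≤ k → k ≤ K → K ≤ k + m →
            ∀ c c' : SubIdx (2 ^ k), c ≠ c' → Sib c c' → IntP k c →
              ∫⁻ X, pairCount ρ N k c c' X ^ 2 * (‖Ψ.ψ X‖₊ : ENNReal) ^ 2 ≤
                ENNReal.ofReal (C * ρ ^ 2 * (sideLength ρ N / 2 ^ k) ^ 6) := by
  obtain ⟨ρ₁, hρ₁, H⟩ := hfin
  refine ⟨ρ₁, hρ₁, fun ρ hρ hρlt m => ⟨(8 / a + 2 * Real.sqrt ρ) ^ 6 / ρ ^ 2, by positivity, 1, one_pos, ?_⟩⟩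
  filter_upwards [H ρ hρ hρlt] with N hN
  refine ⟨1, one_pos, fun Ψ hΨ => Or.inr fun K k hK1 _ _ hkK _ c c' _ hs _ => ?_⟩
  exact pairSecondMoment_hardCore ha hcore hρ hN Ψ hΨ hK1 hkK c c' hs


/-- **Dilute finite energy** (any finite-range repulsive `v`, hard cores allowed): for `ρ < 1/(2(1+R)³)` the Dirichlet
ground-state energy `E₀^D(N, L_N(ρ))` is finite for all large `N` (from the tree's Ruelle bound `e⁺(ρ) < ⊤`,
`limsup_lt_top_of_small`). -/
theorem eventually_groundStateEnergy_lt_top {v : ℝ → ℝ≥0∞} (hv : IsRepulsiveFiniteRange v) :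
    ∃ ρ₁ : ℝ, 0 < ρ₁ ∧ ∀ ρ : ℝ, 0 < ρ → ρ < ρ₁ → ∀ᶠ N : ℕ in Filter.atTop,
      groundStateEnergy v N (sideLength ρ N) < ⊤ := by
  obtain ⟨R, hR, hv0⟩ := hv.exists_pos_range
  refine ⟨1 / (2 * (1 + R) ^ 3), by positivity, fun ρ hρ hρlt => ?_⟩
  have h3 : 0 < (1 + R) ^ 3 := by positivity
  have hsmall : ρ * (1 + R) ^ 3 < 1 := by
    rw [lt_div_iff₀ (by positivity)] at hρlt
    nlinarith
  have hfinl : limsupEnergyPerParticle v ρ < ⊤ := limsup_lt_top_of_small hv.1 hv0 hR hρ hsmall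
  have hev : ∀ᶠ N : ℕ in Filter.atTop, energyPerParticleDirichlet v ρ N < ⊤ :=
    Filter.eventually_lt_of_limsup_lt hfinl
  filter_upwards [hev] with N hN
  refine lt_top_iff_ne_top.2 fun h => ?_
  rw [energyPerParticleDirichlet, h, ENNReal.top_div_of_ne_top (ENNReal.natCast_ne_top N)] at hN
  exact lt_irrefl _ hN

/-- **BC5 WITNESS (unconditional): I3 = `PairSecondMomentP` holds at every finite-range potential with a genuine hard
core** — a regime in which the summit conjunct (BEC) is open. Same quantifier body as the registered stub, `v` fixed. -/
theorem pairSecondMomentP_of_hardCore {a : ℝ} (ha : 0 < a) {v : ℝ → ℝ≥0∞} (hv : IsRepulsiveFiniteRange v)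
    (hcore : ∀ r, r < a → v r = ⊤) :
    ∃ ρ₀ : ℝ, 0 < ρ₀ ∧ ∀ ρ : ℝ, 0 < ρ → ρ < ρ₀ →
    ∀ m : ℕ, ∃ C : ℝ, 0 < C ∧ ∃ c₀ : ℝ, 0 < c₀ ∧ ∀ᶠ N : ℕ in Filter.atTop, ∃ δ : ENNReal, 0 < δ ∧
      ∀ Ψ : TrialState N (sideLength ρ N), energy v Ψ ≤ groundStateEnergy v N (sideLength ρ N) + δ →
        ENNReal.ofReal (c₀ * N) ≤ maxOccupation N Ψ.ψ ∨
          ∀ K k : ℕ, 1 / Real.sqrt ρ ≤ sideLength ρ N / 2 ^ K → sideLength ρ N / 2 ^ K < 2 * (1 / Real.sqrt ρ) →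
            1 ≤ k → k ≤ K → K ≤ k + m →
            ∀ c c' : SubIdx (2 ^ k), c ≠ c' → Sib c c' → IntP k c →
              ∫⁻ X, pairCount ρ N k c c' X ^ 2 * (‖Ψ.ψ X‖₊ : ENNReal) ^ 2 ≤
                ENNReal.ofReal (C * ρ ^ 2 * (sideLength ρ N / 2 ^ k) ^ 6) :=
  pairSecondMomentP_hardCore ha hcore (eventually_groundStateEnergy_lt_top hv)

/-- … in particular for LSSY's hard-sphere gas `hardCorePotential a`. -/
theorem pairSecondMomentP_hardCorePotential {a : ℝ} (ha : 0 < a) :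
    ∃ ρ₀ : ℝ, 0 < ρ₀ ∧ ∀ ρ : ℝ, 0 < ρ → ρ < ρ₀ →
    ∀ m : ℕ, ∃ C : ℝ, 0 < C ∧ ∃ c₀ : ℝ, 0 < c₀ ∧ ∀ᶠ N : ℕ in Filter.atTop, ∃ δ : ENNReal, 0 < δ ∧
      ∀ Ψ : TrialState N (sideLength ρ N), energy (hardCorePotential a) Ψ ≤
          groundStateEnergy (hardCorePotential a) N (sideLength ρ N) + δ →
        ENNReal.ofReal (c₀ * N) ≤ maxOccupation N Ψ.ψ ∨
          ∀ K k : ℕ, 1 / Real.sqrt ρ ≤ sideLength ρ N / 2 ^ K → sideLength ρ N / 2 ^ K < 2 * (1 / Real.sqrt ρ) →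
            1 ≤ k → k ≤ K → K ≤ k + m →
            ∀ c c' : SubIdx (2 ^ k), c ≠ c' → Sib c c' → IntP k c →
              ∫⁻ X, pairCount ρ N k c c' X ^ 2 * (‖Ψ.ψ X‖₊ : ENNReal) ^ 2 ≤
                ENNReal.ofReal (C * ρ ^ 2 * (sideLength ρ N / 2 ^ k) ^ 6) :=
  pairSecondMomentP_of_hardCore ha (isRepulsiveFiniteRange_hardCorePotential a)
    (fun _ hr => hardCorePotential_of_lt hr)

end Summit.AtomisticToContinuum.BoseEinsteinCondensation.Theorems.NumberPhaseSandwichHardCoreRung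

end
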